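import Summits.Ventures.LatticeQCDFlow.Scoring.U1CharacterExpansion
import HarnessLib

/-!
# The finite-torus character formula of two-dimensional U(1) lattice gauge theory

HONEST FRAMING: exact (Metropolis-corrected) sampling algorithms for lattice gauge theory;
figures of merit are autocorrelation/cost numbers at stated couplings and volumes; no
continuum-physics claim.

Venture `LatticeQCDFlow` (cell pub-lqcd), sub-topic `Scoring`; FANOUT row 5 (`s0-sun-a`), GEN-7.
NEW WORK of the cell (placement rule), continuing `Scoring/U1CharacterExpansion.lean` (the duality
formula `Z = (2π)^{n+1} Σ_{m : ι → ℤ} [∀ l, Σ_p m_p inc p l = 0] ∏_p I_{|m_p|}(β_p)` on any finite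
complex):

* §1–2 **closed connected complexes.**  If every link has zero total incidence
  (`hclosed : ∀ l, Σ_p inc p l = 0` — each link is traversed once forwards and once backwards) and
  the only integer plaquette assignments with zero net charge on every link are the constants
  (`hconn`), then the constrained sum collapses to a sum over `ℤ`:
  **`u1WilsonZ_eq_tsum_const`** `Z = (2π)^{n+1} Σ_{k ∈ ℤ} ∏_p I_{|k|}(β_p)`; with a probe character
  `e^{i s θ_{p₀}}` the admissible assignments are `k − s·[p = p₀]`
  (`setIntegral_cexp_plaq_mul_weight`), whence the plaquette numerator
  **`setIntegral_cos_plaq_mul_weight`**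
  `∫ cos θ_{p₀} W = (2π)^{n+1} Σ_k (∏_{p ≠ p₀} I_{|k|}(β_p)) (I_{|k−1|} + I_{|k+1|})(β_{p₀})/2` and the
  Wilson expectation **`u1WilsonExpect_cos_plaq`**
  `⟨cos θ_{p₀}⟩ = Σ_k (∏_{p ≠ p₀} I_{|k|}(β_p)) (I_{|k−1|} + I_{|k+1|})(β_{p₀})/2 / Σ_k ∏_p I_{|k|}(β_p)`
  (uniform coupling: `Σ_k I_k^{V−1} I_k' / Σ_k I_k^V` with `I_k' = (I_{k−1} + I_{k+1})/2`, `V = #ι` —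
  `u1WilsonExpect_cos_plaq_uniform`);
* §3 **the `L₁ × L₂` periodic square lattice** (plaquettes `Fin L₁ × Fin L₂`, links
  `Fin 2 × (Fin L₁ × Fin L₂)` enumerated by any `e : _ ≃ Fin (n + 1)`, incidence `torusInc e`:
  `θ_p(x) = θ₁(x) + θ₂(x + e₁) − θ₁(x + e₂) − θ₂(x)`) satisfies `hclosed` and `hconn`
  (`torusInc_closed`, `torusInc_conn`: the link constraints force `m(x + e₁) = m(x) = m(x + e₂)`),
  so **`torus_u1WilsonZ`** `Z_{L₁×L₂}(β) = (2π)^{n+1} Σ_{k ∈ ℤ} I_{|k|}(β)^{L₁L₂}` and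
  **`torus_u1WilsonExpect_cos_plaq`**
  `⟨cos θ_p⟩_{L₁×L₂, β} = Σ_k I_{|k|}(β)^{L₁L₂−1} (I_{|k−1|}(β) + I_{|k+1|}(β))/2 / Σ_k I_{|k|}(β)^{L₁L₂}`
  for every `L₁, L₂ ≥ 1` — the formula the cell's exact 2-d U(1) oracle evaluates
  (`ref-exact` `ORACLE-u1-2d.json`, X01; row 5 `ORACLE-TABLE-S0-C-A.md`, `I_n' = (I_{n−1}+I_{n+1})/2`),
  whose `V → ∞` limit `I₁(β)/I₀(β)` is enclosed in `Scoring/OnePlaquetteEnclosures.lean`.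

References: the torus formula is the genus-one case of the character expansion of two-dimensional
Yang–Mills / lattice gauge theory (A. A. Migdal, Sov. Phys. JETP 42 (1975) 413; for U(1) e.g.
Drouffe–Zuber, Phys. Rep. 102 (1983) §3); we re-derive it in the cell's coordinates.  NOT here:
non-abelian groups, Wilson loops larger than one plaquette, numerical enclosures of the torus sums;
the one-defect partition function `torus_u1WilsonZ_defect` is included (free-energy-defect oracle).
-/

noncomputable section

open scoped Nat
open Real MeasureTheory Set Finset Literature.Analysis.FunctionSpaces

namespace Summit.Ventures.LatticeQCDFlow.Scoring

/-! ### 1. Reindexing a constrained sum -/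

/-- If the assignments satisfying `P` are exactly the range of an injective parametrisation
`g : ℤ → (ι → ℤ)`, the constrained sum over `ι → ℤ` is the unconstrained sum over `ℤ`. -/
theorem tsum_ite_eq_tsum_of_range {ι α : Type*} [AddCommMonoid α] [TopologicalSpace α]
    {F : (ι → ℤ) → α} {P : (ι → ℤ) → Prop} [DecidablePred P]
    (g : ℤ → (ι → ℤ)) (hg : Function.Injective g) (hP : ∀ m, P m ↔ m ∈ Set.range g) :
    ∑' m, (if P m then F m else 0) = ∑' k, F (g k) := by
  have hsupp : Function.support (fun m => if P m then F m else 0) ⊆ Set.range g := by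
    intro m hm
    rw [Function.mem_support] at hm
    by_contra hr
    exact hm (if_neg (mt (hP m).mp hr))
  rw [← hg.tsum_eq hsupp]
  exact tsum_congr fun k => if_pos ((hP _).mpr ⟨k, rfl⟩)

/-! ### 2. Closed connected complexes -/

section Closed

variable {n : ℕ} {ι : Type*} [Fintype ι] [DecidableEq ι] (inc : ι → Fin (n + 1) → ℤ) (βp : ι → ℝ)

/-- On a closed complex (`Σ_p inc p l = 0` on every link) whose charge-free assignments are the
constants, the assignments `m` with `s · inc p₀ + Σ_p m_p inc p = 0` on every link are exactly
`m = k − s·[· = p₀]`, `k ∈ ℤ`. -/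
theorem linkConstraint_iff_mem_range (hclosed : ∀ l, ∑ p, inc p l = 0)
    (hconn : ∀ m : ι → ℤ, (∀ l, ∑ p, m p * inc p l = 0) → ∀ p q, m p = m q)
    (p₀ : ι) (s : ℤ) (m : ι → ℤ) :
    (∀ l, s * inc p₀ l + ∑ p, m p * inc p l = 0) ↔
      m ∈ Set.range fun k : ℤ => fun p => k - if p = p₀ then s else 0 := by
  constructor
  · intro h
    -- the shifted assignment `m + s·[· = p₀]` is charge-free, hence constant
    have h' : ∀ l, ∑ p, (m p + if p = p₀ then s else 0) * inc p l = 0 := by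
      intro l
      have hsplit : ∑ p, (m p + if p = p₀ then s else 0) * inc p l =
          ∑ p, m p * inc p l + s * inc p₀ l := by
        simp only [add_mul, Finset.sum_add_distrib, ite_mul, zero_mul, Finset.sum_ite_eq',
          Finset.mem_univ, if_true]
      linarith [h l]
    refine ⟨m p₀ + s, funext fun p => ?_⟩
    show m p₀ + s - (if p = p₀ then s else 0) = m p
    have hc := hconn _ h' p p₀
    rw [if_pos rfl] at hc
    by_cases hp : p = p₀
    · subst hp
      rw [if_pos rfl, add_sub_cancel_right]
    · rw [if_neg hp, add_zero] at hc
      rw [if_neg hp, sub_zero, hc]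
  · rintro ⟨k, rfl⟩ l
    have hsplit : ∑ p, (k - if p = p₀ then s else 0) * inc p l =
        k * ∑ p, inc p l - s * inc p₀ l := by
      simp only [sub_mul, Finset.sum_sub_distrib, ite_mul, zero_mul, Finset.sum_ite_eq',
        Finset.mem_univ, if_true, Finset.mul_sum]
    rw [hsplit, hclosed l, mul_zero]
    ring

omit [Fintype ι] [DecidableEq ι] in
/-- The parametrisation `k ↦ k − s·[· = p₀]` is injective (`ι` non-empty). -/
theorem injective_const_sub_ite [DecidableEq ι] [Nonempty ι] (p₀ : ι) (s : ℤ) :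
    Function.Injective fun k : ℤ => fun p : ι => k - if p = p₀ then s else 0 := by
  intro k k' h
  have := congr_fun h p₀
  simpa using this

/-- **The partition function of a closed connected complex**:
`Z = (2π)^{n+1} Σ_{k ∈ ℤ} ∏_p I_{|k|}(β_p)`. -/
theorem u1WilsonZ_eq_tsum_const [Nonempty ι] (hclosed : ∀ l, ∑ p, inc p l = 0)
    (hconn : ∀ m : ι → ℤ, (∀ l, ∑ p, m p * inc p l = 0) → ∀ p q, m p = m q) :
    u1WilsonZ univ inc βp = (2 * π) ^ (n + 1) * ∑' k : ℤ, ∏ p, besselI k.natAbs (βp p) := by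
  obtain ⟨p₀⟩ := ‹Nonempty ι›
  rw [u1WilsonZ_univ_eq_tsum]
  congr 1
  have hP : ∀ m : ι → ℤ, (∀ l, ∑ p, m p * inc p l = 0) ↔
      m ∈ Set.range fun k : ℤ => fun p => k - if p = p₀ then (0 : ℤ) else 0 := fun m => by
    rw [← linkConstraint_iff_mem_range inc hclosed hconn p₀ 0 m]
    simp
  rw [tsum_ite_eq_tsum_of_range _ (injective_const_sub_ite p₀ 0) hP]
  simp

/-- **Probe character**: `∫ e^{i s θ_{p₀}} W dθ = (2π)^{n+1} Σ_{k ∈ ℤ} ∏_p I_{|k − s·[p = p₀]|}(β_p)`. -/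
theorem setIntegral_cexp_plaq_mul_weight [Nonempty ι] (hclosed : ∀ l, ∑ p, inc p l = 0)
    (hconn : ∀ m : ι → ℤ, (∀ l, ∑ p, m p * inc p l = 0) → ∀ p q, m p = m q) (p₀ : ι) (s : ℤ) :
    ∫ θ in u1TorusBox (n + 1), Complex.exp ((s : ℂ) * u1PlaqAngle inc p₀ θ * Complex.I) *
        ((u1WilsonWeight univ inc βp θ : ℝ) : ℂ) =
      (2 * π : ℂ) ^ (n + 1) *
        ∑' k : ℤ, ∏ p, (besselI (k - if p = p₀ then s else 0).natAbs (βp p) : ℂ) := by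
  have hphase : ∀ θ : Fin (n + 1) → ℝ, (s : ℂ) * u1PlaqAngle inc p₀ θ * Complex.I =
      (∑ l, ((s * inc p₀ l : ℤ) : ℂ) * θ l) * Complex.I := fun θ => by
    simp only [u1PlaqAngle]
    push_cast
    rw [Finset.mul_sum, Finset.sum_mul, Finset.sum_mul]
    exact Finset.sum_congr rfl fun l _ => by ring
  simp_rw [hphase]
  have h := setIntegral_cexp_mul_u1WilsonWeight inc βp fun l => s * inc p₀ l
  rw [h]
  congr 1
  exact tsum_ite_eq_tsum_of_range _ (injective_const_sub_ite p₀ s)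
    (linkConstraint_iff_mem_range inc hclosed hconn p₀ s)

/-- Splitting off the probed plaquette: `∏_p I_{|k − s[p = p₀]|}(β_p) = I_{|k−s|}(β_{p₀}) ∏_{p ≠ p₀} I_{|k|}(β_p)`. -/
theorem prod_besselI_sub_ite (p₀ : ι) (k s : ℤ) :
    ∏ p, besselI (k - if p = p₀ then s else 0).natAbs (βp p) =
      besselI (k - s).natAbs (βp p₀) * ∏ p ∈ univ.erase p₀, besselI k.natAbs (βp p) := by
  rw [← Finset.mul_prod_erase univ (fun p => besselI (k - if p = p₀ then s else 0).natAbs (βp p))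
    (Finset.mem_univ p₀)]
  simp only
  congr 1
  exact Finset.prod_congr rfl fun p hp => by rw [if_neg (Finset.ne_of_mem_erase hp), sub_zero]

/-- The shifted products are summable over `k`. -/
theorem summable_prod_besselI_sub_ite [Nonempty ι] (p₀ : ι) (s : ℤ) :
    Summable fun k : ℤ => ∏ p, besselI (k - if p = p₀ then s else 0).natAbs (βp p) := by
  have h := ((summable_norm_prod_besselI βp).of_norm.comp_injective
    (injective_const_sub_ite p₀ s))
  have h2 := Complex.reCLM.summable h
  refine h2.congr fun k => ?_
  simp only [Function.comp_apply, Complex.reCLM_apply, ← Complex.ofReal_prod, Complex.ofReal_re]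

/-- **The plaquette numerator on a closed connected complex**:
`∫ cos θ_{p₀} W dθ = (2π)^{n+1} Σ_k (∏_{p ≠ p₀} I_{|k|}(β_p)) · (I_{|k−1|}(β_{p₀}) + I_{|k+1|}(β_{p₀}))/2`. -/
theorem setIntegral_cos_plaq_mul_weight [Nonempty ι] (hclosed : ∀ l, ∑ p, inc p l = 0)
    (hconn : ∀ m : ι → ℤ, (∀ l, ∑ p, m p * inc p l = 0) → ∀ p q, m p = m q) (p₀ : ι) :
    ∫ θ in u1TorusBox (n + 1), Real.cos (u1PlaqAngle inc p₀ θ) * u1WilsonWeight univ inc βp θ =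
      (2 * π) ^ (n + 1) * ∑' k : ℤ, (∏ p ∈ univ.erase p₀, besselI k.natAbs (βp p)) *
        ((besselI (k - 1).natAbs (βp p₀) + besselI (k + 1).natAbs (βp p₀)) / 2) := by
  have hW := continuous_u1WilsonWeight univ inc βp
  have hA := continuous_u1PlaqAngle inc p₀
  -- the two probe integrals `s = ±1`
  have hI : ∀ s : ℤ, Integrable (fun θ : Fin (n + 1) → ℝ =>
      Complex.exp ((s : ℂ) * u1PlaqAngle inc p₀ θ * Complex.I) *
        ((u1WilsonWeight univ inc βp θ : ℝ) : ℂ))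
      ((volume : Measure (Fin (n + 1) → ℝ)).restrict (u1TorusBox (n + 1))) := fun s =>
    integrableOn_u1TorusBox' (by fun_prop)
  have h1 := setIntegral_cexp_plaq_mul_weight inc βp hclosed hconn p₀ 1
  have h2 := setIntegral_cexp_plaq_mul_weight inc βp hclosed hconn p₀ (-1)
  -- complexify the real integral
  apply Complex.ofReal_injective
  rw [← integral_complex_ofReal]
  have hsplit : ∀ θ : Fin (n + 1) → ℝ,
      (((Real.cos (u1PlaqAngle inc p₀ θ) * u1WilsonWeight univ inc βp θ : ℝ)) : ℂ) =
        (1 / 2 : ℂ) * (Complex.exp (((1 : ℤ) : ℂ) * u1PlaqAngle inc p₀ θ * Complex.I) *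
            ((u1WilsonWeight univ inc βp θ : ℝ) : ℂ)) +
          (1 / 2 : ℂ) * (Complex.exp (((-1 : ℤ) : ℂ) * u1PlaqAngle inc p₀ θ * Complex.I) *
            ((u1WilsonWeight univ inc βp θ : ℝ) : ℂ)) := fun θ => by
    push_cast
    rw [Complex.cos]
    ring_nf
  simp_rw [hsplit]
  rw [integral_add ((hI 1).const_mul _) ((hI (-1)).const_mul _), MeasureTheory.integral_const_mul,
    MeasureTheory.integral_const_mul, h1, h2]
  -- massage the two character sums (a real identity)
  have hs1 := summable_prod_besselI_sub_ite βp p₀ 1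
  have hs2 := summable_prod_besselI_sub_ite βp p₀ (-1)
  have key : ∑' k : ℤ, (∏ p ∈ univ.erase p₀, besselI k.natAbs (βp p)) *
        ((besselI (k - 1).natAbs (βp p₀) + besselI (k + 1).natAbs (βp p₀)) / 2) =
      1 / 2 * ∑' k : ℤ, ∏ p, besselI (k - if p = p₀ then (1 : ℤ) else 0).natAbs (βp p) +
        1 / 2 * ∑' k : ℤ, ∏ p, besselI (k - if p = p₀ then (-1 : ℤ) else 0).natAbs (βp p) := by
    rw [← tsum_mul_left, ← tsum_mul_left, ← (hs1.mul_left _).tsum_add (hs2.mul_left _)]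
    refine tsum_congr fun k => ?_
    rw [prod_besselI_sub_ite, prod_besselI_sub_ite, sub_neg_eq_add]
    ring
  have hreal : (2 * π) ^ (n + 1) * ∑' k : ℤ, (∏ p ∈ univ.erase p₀, besselI k.natAbs (βp p)) *
        ((besselI (k - 1).natAbs (βp p₀) + besselI (k + 1).natAbs (βp p₀)) / 2) =
      1 / 2 * ((2 * π) ^ (n + 1) *
          ∑' k : ℤ, ∏ p, besselI (k - if p = p₀ then (1 : ℤ) else 0).natAbs (βp p)) +
        1 / 2 * ((2 * π) ^ (n + 1) *
          ∑' k : ℤ, ∏ p, besselI (k - if p = p₀ then (-1 : ℤ) else 0).natAbs (βp p)) := by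
    rw [key]
    ring
  rw [hreal]
  push_cast
  ring

/-- **The plaquette expectation on a closed connected complex**:
`⟨cos θ_{p₀}⟩ = Σ_k (∏_{p ≠ p₀} I_{|k|}(β_p)) (I_{|k−1|} + I_{|k+1|})(β_{p₀})/2 / Σ_k ∏_p I_{|k|}(β_p)`. -/
theorem u1WilsonExpect_cos_plaq [Nonempty ι] (hclosed : ∀ l, ∑ p, inc p l = 0)
    (hconn : ∀ m : ι → ℤ, (∀ l, ∑ p, m p * inc p l = 0) → ∀ p q, m p = m q) (p₀ : ι) :
    u1WilsonExpect univ inc βp (fun θ => Real.cos (u1PlaqAngle inc p₀ θ)) =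
      (∑' k : ℤ, (∏ p ∈ univ.erase p₀, besselI k.natAbs (βp p)) *
          ((besselI (k - 1).natAbs (βp p₀) + besselI (k + 1).natAbs (βp p₀)) / 2)) /
        ∑' k : ℤ, ∏ p, besselI k.natAbs (βp p) := by
  rw [u1WilsonExpect, setIntegral_cos_plaq_mul_weight inc βp hclosed hconn,
    u1WilsonZ_eq_tsum_const inc βp hclosed hconn,
    mul_div_mul_left _ _ (by positivity : (2 * π : ℝ) ^ (n + 1) ≠ 0)]

/-- **Uniform coupling**: with `β_p = β` for all `p` and `V = #ι` plaquettes,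
`⟨cos θ_{p₀}⟩ = Σ_k I_{|k|}(β)^{V−1} (I_{|k−1|}(β) + I_{|k+1|}(β))/2 / Σ_k I_{|k|}(β)^V`
(`V − 1` is natural-number subtraction, harmless since `V ≥ 1` by `Nonempty ι`). -/
theorem u1WilsonExpect_cos_plaq_uniform [Nonempty ι] (hclosed : ∀ l, ∑ p, inc p l = 0)
    (hconn : ∀ m : ι → ℤ, (∀ l, ∑ p, m p * inc p l = 0) → ∀ p q, m p = m q) (β : ℝ) (p₀ : ι) :
    u1WilsonExpect univ inc (fun _ => β) (fun θ => Real.cos (u1PlaqAngle inc p₀ θ)) =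
      (∑' k : ℤ, besselI k.natAbs β ^ (Fintype.card ι - 1) *
          ((besselI (k - 1).natAbs β + besselI (k + 1).natAbs β) / 2)) /
        ∑' k : ℤ, besselI k.natAbs β ^ Fintype.card ι := by
  rw [u1WilsonExpect_cos_plaq inc _ hclosed hconn p₀]
  simp only [Finset.prod_const, Finset.card_erase_of_mem (Finset.mem_univ p₀), Finset.card_univ]

end Closed

/-! ### 3. The `L₁ × L₂` periodic square lattice -/

section Torus

variable {L₁ L₂ : ℕ} [NeZero L₁] [NeZero L₂] {n : ℕ}
  (e : Fin 2 × (Fin L₁ × Fin L₂) ≃ Fin (n + 1))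

/-- **The plaquette–link incidence of the `L₁ × L₂` torus.**  Plaquettes are labelled by their
lower-left site `x`, links by `(d, y)` = the link leaving site `y` in direction `d` (enumerated
by `e`); the plaquette at `x` runs through `(0, x)` and `(1, x + e₁)` forwards and through
`(0, x + e₂)` and `(1, x)` backwards: `θ_p(x) = θ₁(x) + θ₂(x + e₁) − θ₁(x + e₂) − θ₂(x)`.
Coincident links (possible when `L₁` or `L₂` is `1`) add their incidences. -/
def torusInc (x : Fin L₁ × Fin L₂) (l : Fin (n + 1)) : ℤ :=
  if (e.symm l).1 = 0 then
    (if (e.symm l).2 = x then 1 else 0) - (if (e.symm l).2 = (x.1, x.2 + 1) then 1 else 0)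
  else
    (if (e.symm l).2 = (x.1 + 1, x.2) then 1 else 0) - (if (e.symm l).2 = x then 1 else 0)

/-- Every link of the torus is traversed once forwards and once backwards: `Σ_x inc x l = 0`. -/
theorem torusInc_closed (l : Fin (n + 1)) : ∑ x, torusInc e x l = 0 := by
  unfold torusInc
  generalize e.symm l = dy
  obtain ⟨d, y⟩ := dy
  have h2 : ∀ x : Fin L₁ × Fin L₂, (y = (x.1, x.2 + 1)) ↔ (x = (y.1, y.2 - 1)) := fun x => by
    constructor
    · rintro rfl; simp
    · rintro rfl; simp
  have h1 : ∀ x : Fin L₁ × Fin L₂, (y = (x.1 + 1, x.2)) ↔ (x = (y.1 - 1, y.2)) := fun x => by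
    constructor
    · rintro rfl; simp
    · rintro rfl; simp
  simp only
  split_ifs
  · simp_rw [h2]
    simp [Finset.sum_sub_distrib]
  · simp_rw [h1]
    simp [Finset.sum_sub_distrib]

open Fin.NatCast in -- `ℕ → Fin L` casts, used only inside the proof (walking to the origin)
/-- The torus is connected through its links: an integer plaquette assignment with zero net charge
on every link is constant (the constraint at the link `(1, y)` reads `m(y − e₁) = m(y)`, at
`(0, y)` it reads `m(y) = m(y − e₂)`). -/
theorem torusInc_conn (m : Fin L₁ × Fin L₂ → ℤ) (hm : ∀ l, ∑ x, m x * torusInc e x l = 0)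
    (p q : Fin L₁ × Fin L₂) : m p = m q := by
  have h2 : ∀ x : Fin L₁ × Fin L₂, ∀ y : Fin L₁ × Fin L₂,
      (y = (x.1, x.2 + 1)) ↔ (x = (y.1, y.2 - 1)) := fun x y => by
    constructor
    · rintro rfl; simp
    · rintro rfl; simp
  have h1 : ∀ x : Fin L₁ × Fin L₂, ∀ y : Fin L₁ × Fin L₂,
      (y = (x.1 + 1, x.2)) ↔ (x = (y.1 - 1, y.2)) := fun x y => by
    constructor
    · rintro rfl; simp
    · rintro rfl; simp
  -- the constraint at the direction-0 link leaving `y`: `m y = m (y.1, y.2 - 1)`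
  have hv : ∀ y : Fin L₁ × Fin L₂, m y = m (y.1, y.2 - 1) := fun y => by
    have h := hm (e (0, y))
    simp only [torusInc, Equiv.symm_apply_apply, ↓reduceIte, mul_sub, mul_ite, mul_one, mul_zero,
      Finset.sum_sub_distrib] at h
    simp_rw [h2 _ y] at h
    simp only [Finset.sum_ite_eq, Finset.sum_ite_eq', Finset.mem_univ, if_true] at h
    linarith
  -- the constraint at the direction-1 link leaving `y`: `m (y.1 - 1, y.2) = m y`
  have hh : ∀ y : Fin L₁ × Fin L₂, m y = m (y.1 - 1, y.2) := fun y => by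
    have h := hm (e (1, y))
    simp only [torusInc, Equiv.symm_apply_apply, one_ne_zero, ↓reduceIte, mul_sub, mul_ite,
      mul_one, mul_zero, Finset.sum_sub_distrib] at h
    simp_rw [h1 _ y] at h
    simp only [Finset.sum_ite_eq, Finset.sum_ite_eq', Finset.mem_univ, if_true] at h
    linarith
  -- walk from any site to the origin
  have hv' : ∀ (a : Fin L₁) (k : ℕ), m (a, (k : Fin L₂)) = m (a, 0) := fun a k => by
    induction k with
    | zero => rw [Nat.cast_zero]
    | succ k ih =>
      rw [Nat.cast_succ, hv (a, (k : Fin L₂) + 1)]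
      simpa using ih
  have hh' : ∀ (k : ℕ), m ((k : Fin L₁), 0) = m (0, 0) := fun k => by
    induction k with
    | zero => rw [Nat.cast_zero]
    | succ k ih =>
      rw [Nat.cast_succ, hh ((k : Fin L₁) + 1, 0)]
      simpa using ih
  have hall : ∀ x : Fin L₁ × Fin L₂, m x = m (0, 0) := fun x => by
    obtain ⟨a, b⟩ := x
    calc m (a, b) = m (a, ((b.val : ℕ) : Fin L₂)) := by rw [Fin.cast_val_eq_self]
      _ = m (a, 0) := hv' a b.val
      _ = m (((a.val : ℕ) : Fin L₁), 0) := by rw [Fin.cast_val_eq_self]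
      _ = m (0, 0) := hh' a.val
  rw [hall p, hall q]

/-- **The partition function of the 2-d U(1) torus** (`L₁, L₂ ≥ 1`, per-plaquette couplings):
`Z = (2π)^{n+1} Σ_{k ∈ ℤ} ∏_x I_{|k|}(β_x)`. -/
theorem torus_u1WilsonZ (βp : Fin L₁ × Fin L₂ → ℝ) :
    u1WilsonZ univ (torusInc e) βp = (2 * π) ^ (n + 1) * ∑' k : ℤ, ∏ x, besselI k.natAbs (βp x) :=
  u1WilsonZ_eq_tsum_const _ βp (torusInc_closed e) (torusInc_conn e)

/-- **Uniform coupling**: `Z_{L₁×L₂}(β) = (2π)^{n+1} Σ_{k ∈ ℤ} I_{|k|}(β)^{L₁L₂}`. -/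
theorem torus_u1WilsonZ_uniform (β : ℝ) :
    u1WilsonZ univ (torusInc e) (fun _ => β) =
      (2 * π) ^ (n + 1) * ∑' k : ℤ, besselI k.natAbs β ^ (L₁ * L₂) := by
  rw [torus_u1WilsonZ]
  simp [Finset.prod_const, Finset.card_univ]

/-- **One defect plaquette** (exterior at coupling `β`, the plaquette `x₀` at `β'` — the shape of
the cell's free-energy-defect / Jarzynski oracle):
`Z_{β, x₀ ↦ β'} = (2π)^{n+1} Σ_{k ∈ ℤ} I_{|k|}(β') I_{|k|}(β)^{L₁L₂−1}`, hence
`Z_{β, x₀ ↦ β'} / Z_β = Σ_k I_{|k|}(β') I_{|k|}(β)^{L₁L₂−1} / Σ_k I_{|k|}(β)^{L₁L₂}`. -/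
theorem torus_u1WilsonZ_defect (β β' : ℝ) (x₀ : Fin L₁ × Fin L₂) :
    u1WilsonZ univ (torusInc e) (Function.update (fun _ => β) x₀ β') =
      (2 * π) ^ (n + 1) * ∑' k : ℤ, besselI k.natAbs β' * besselI k.natAbs β ^ (L₁ * L₂ - 1) := by
  rw [torus_u1WilsonZ]
  congr 1
  refine tsum_congr fun k => ?_
  rw [← Finset.mul_prod_erase univ _ (Finset.mem_univ x₀), Function.update_self,
    Finset.prod_congr rfl fun x hx => by rw [Function.update_of_ne (Finset.ne_of_mem_erase hx)],
    Finset.prod_const, Finset.card_erase_of_mem (Finset.mem_univ x₀), Finset.card_univ,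
    Fintype.card_prod, Fintype.card_fin, Fintype.card_fin]

/-- The defect free-energy ratio `Z_{β, x₀ ↦ β'} / Z_β` of the 2-d U(1) torus. -/
theorem torus_u1WilsonZ_defect_div (β β' : ℝ) (x₀ : Fin L₁ × Fin L₂) :
    u1WilsonZ univ (torusInc e) (Function.update (fun _ => β) x₀ β') /
        u1WilsonZ univ (torusInc e) (fun _ => β) =
      (∑' k : ℤ, besselI k.natAbs β' * besselI k.natAbs β ^ (L₁ * L₂ - 1)) /
        ∑' k : ℤ, besselI k.natAbs β ^ (L₁ * L₂) := by
  rw [torus_u1WilsonZ_defect, torus_u1WilsonZ_uniform,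
    mul_div_mul_left _ _ (by positivity : (2 * π : ℝ) ^ (n + 1) ≠ 0)]

/-- **The exact plaquette of the 2-d U(1) torus**: for every `L₁, L₂ ≥ 1`, `β ∈ ℝ` and plaquette
`x₀`, `⟨cos θ_{x₀}⟩_{L₁×L₂, β} = Σ_k I_{|k|}(β)^{L₁L₂−1} (I_{|k−1|}(β) + I_{|k+1|}(β))/2 / Σ_k I_{|k|}(β)^{L₁L₂}`
— the finite-torus character formula the cell's exact 2-d oracle evaluates (its `V → ∞` limit is
`I₁(β)/I₀(β)`; `L₁L₂ − 1` is natural-number subtraction with `L₁L₂ ≥ 1`). -/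
theorem torus_u1WilsonExpect_cos_plaq (β : ℝ) (x₀ : Fin L₁ × Fin L₂) :
    u1WilsonExpect univ (torusInc e) (fun _ => β)
        (fun θ => Real.cos (u1PlaqAngle (torusInc e) x₀ θ)) =
      (∑' k : ℤ, besselI k.natAbs β ^ (L₁ * L₂ - 1) *
          ((besselI (k - 1).natAbs β + besselI (k + 1).natAbs β) / 2)) /
        ∑' k : ℤ, besselI k.natAbs β ^ (L₁ * L₂) := by
  rw [u1WilsonExpect_cos_plaq_uniform _ (torusInc_closed e) (torusInc_conn e)]
  simp [Fintype.card_prod, Fintype.card_fin]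

end Torus

end Summit.Ventures.LatticeQCDFlow.Scoring
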